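import Summits.CriticalPhenomena.PercolationContinuityZ3.Theorems.PercNearOneGluingNoHeavyLowerTailIncStarWDOMTwoProngedCore
import HarnessLib

/-!
# A dangling sure leaf at the root is irrelevant for cluster events that ignore it (Sahi programme, prover prim-sahi-p2 gen 36)

Support file (`--supports stmt-CriticalPhenomena-4575`); no definitions, no named facts, no sorries; standard axioms.  Memo
`run/shared/lean/prim/prim-sahi/FROM-prim-sahi-p2-gen36-ALL-OR-NOTHING.md` §6(2b).

Companion of `real_clusterMem_mergeParallel` (coin merging): after the arms of a sure relay `x` have been merged into the root's gates, `x` is a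
pendant vertex hanging off `s` alone, and **`real_clusterMem_pendant_irrel`** says that for every family `𝒜` of vertex sets insensitive to `x`
(`S ∈ 𝒜 ↔ S ∪ {x} ∈ 𝒜`) the probability `P_w{C_s ∈ 𝒜}` does not depend on the weight of the pair `s–x`.  With both tools a relay cloud with a set
`S` of surely open relays becomes a two-pronged root on the same vertex set, so `allOrNothing_root` / `wdom_twoPronged` apply without contraction.
-/

noncomputable section

namespace Summit.CriticalPhenomena.PercolationContinuityZ3.Theorems

namespace IncStar

open MeasureTheory Set Literature.Probability.Percolation Literature.Probability.LatticeModels EdgeInduction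
open scoped Classical

variable {n : ℕ}

/-- **Pendant irrelevance.**  `x ≠ s`; every pair at `x` other than `s–x` has weight `0`; `𝒜` insensitive to `x`.  Then for every `c`,
`P_w{C_s ∈ 𝒜} = P_{w[s(s,x) ↦ c]}{C_s ∈ 𝒜}`. [this work] -/
theorem real_clusterMem_pendant_irrel (w : Sym2 (Fin n) → unitInterval) {s x : Fin n} (hxs : x ≠ s)
    (hpend : ∀ v : Fin n, v ≠ s → w s(x, v) = 0)
    (𝒜 : Set (Set (Fin n))) (h𝒜 : ∀ S : Set (Fin n), S ∈ 𝒜 ↔ insert x S ∈ 𝒜) (c : unitInterval) :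
    (prodBernoulli w).real {ω | openCluster ω s ∈ 𝒜} = (prodBernoulli (Function.update w s(s, x) c)).real {ω | openCluster ω s ∈ 𝒜} := by
  set e : Sym2 (Fin n) := s(s, x) with he
  set X : Set (BondConfig (Fin n)) := {ω | openCluster ω s ∈ 𝒜} with hX
  have key : (prodBernoulli (Function.update w e 1)).real X = (prodBernoulli (Function.update w e 0)).real X := by
    -- push-forward `P_{w[e↦1]} = P_{w[e↦0]} ∘ (insert e)⁻¹` and the pendant cluster identity on the sure set of `P_{w[e↦0]}`
    have hmap := goodStepEI_prodBernoulli_map_insert (Function.update w e 0) e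
    rw [Function.update_idem] at hmap
    have hmeas : Measurable fun ω : BondConfig (Fin n) => insert e ω := by
      refine measurable_set_iff.2 fun t => ?_
      simp only [Set.mem_insert_iff]
      exact measurable_const.or (measurable_set_mem t)
    have pre : (prodBernoulli (Function.update w e 1)).real X =
        (prodBernoulli (Function.update w e 0)).real ((fun ω : BondConfig (Fin n) => insert e ω) ⁻¹' X) := by
      rw [← hmap, measureReal_def, measureReal_def, Measure.map_apply hmeas MeasurableSet.of_discrete]
    rw [pre]
    have hG0 := real_sureSet (Function.update w e 0)
    refine real_congr_on_sure hG0 fun ω hω => ?_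
    have hiso : ∀ v : Fin n, v ≠ s → s(x, v) ∉ ω := by
      intro v hv
      apply hω.2
      have hne : s(x, v) ≠ e := by
        rw [he]; intro h; rw [Sym2.eq_iff] at h
        rcases h with ⟨h1, _⟩ | ⟨_, h2⟩
        · exact hxs h1
        · exact hv h2
      rw [Function.update_of_ne hne]; exact hpend v hv
    simp only [Set.mem_preimage, hX, Set.mem_setOf_eq]
    rw [openCluster_insert_pendant hxs hiso]
    exact (h𝒜 _).symm
  rw [stub_oneBondDecomp_k15 n w e X, stub_oneBondDecomp_k15 n (Function.update w e c) e X, Function.update_idem, Function.update_idem,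
    key]
  simp only [Function.update_self]
  ring

end IncStar

end Summit.CriticalPhenomena.PercolationContinuityZ3.Theorems
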